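import Summits.CriticalPhenomena.PercolationContinuityZ3.Theorems.PercNearOneGluingNoHeavyLowerTailSahiCTCRtLumped
import Summits.CriticalPhenomena.PercolationContinuityZ3.Theorems.PercNearOneGluingNoHeavyLowerTailSahiCTCLumpedVertex
import Summits.CriticalPhenomena.PercolationContinuityZ3.Theorems.PercNearOneGluingNoHeavyLowerTailSahiCTCIdleCornerOne
import Summits.CriticalPhenomena.PercolationContinuityZ3.Theorems.PercNearOneGluingNoHeavyLowerTailSahiCTCCoLevelDuality
import HarnessLib

/-!
# `NoHeavyLowerTail` (crux stmt-CriticalPhenomena-4575), P3 lane: preparation for the one-vertex monotonicity C2 AT LEVEL `t = 2` —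
# traces and Kleitman surpluses of the deletion / link of a pair at a vertex, and the "loop block" (Kleitman twice inside a sub-cube)

Support file (seat `prim-l12-p3`, gen 42; `--supports stmt-CriticalPhenomena-4575`).  Memo
`run/shared/lean/prim/prim-l12/FROM-prim-l12-p3-g42-C2-LEVEL-TWO.md` §2–3.  For up-sets `F, G ⊆ 2^α` and a vertex `v` (`delV v F = {S ∈ F : v ∉ S}`,
`linkV v F = {S ⊆ α−v : S+v ∈ F}` of `…SahiCTCLumpedVertex`; `Π' = GF(delV v 2^α)` = GF of the sets avoiding `v`):
* `tr_delV`, `tr_linkV`, `kap_delV`, `kap_linkV` : on a sub-cube `(D, s)` avoiding `v` the traces of the deletions are the traces of `F, G`, and the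
  traces of the links are the traces of `F, G` at the base `D + v`;
* `coeff_harrisDel_eq_kap`, `coeff_harrisLink_eq_kap`, `coeff_harrisDel_nonneg`, `coeff_harrisLink_nonneg` : the RELATIVE Harris forms
  `Π'·GF(delV F ∩ delV G) − GF(delV F)·GF(delV G)` and `Π'·GF(linkV F ∩ linkV G) − GF(linkV F)·GF(linkV G)` have the coefficients
  `kap F G (dbl n) (sgl n)` and `kap F G (dbl n + v) (sgl n)` at the `v`-free profiles `n ≤ 2`, zero elsewhere, hence are `∈ ℕ[s]`;
* `card_tr_le_card_filter_compl` (KLEITMAN TWICE inside `s`: down×down correlate, down×up anticorrelate) and **`coeff_loopBlock_nonneg`** :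
  `GF(delV 2^α ∖ delV F)·GF(linkV v G) − Π'·GF(W) ∈ ℕ[s]` for every family `W ⊆ delV v G` of non-members of `F` — the block of the C2 difference
  of `R_2` at a vertex that is a loop of `F` but not of `G` (file `…SahiCTCC2LevelTwo`);
* `coeff_gf_le_one`, `exists_mem_ind_eq_of_coeff_gf_pos` : a generating function has `0/1` coefficients.
Nothing is asserted about the crux.
-/

noncomputable section

open scoped Classical

namespace Summit.CriticalPhenomena.PercolationContinuityZ3.Theorems.SahiCTCForms

open Finset MvPolynomial SahiCTCGenFun

variable {α : Type*} [DecidableEq α] [Fintype α]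

/-! ### Traces of deletions and links -/

section Traces
variable (F G : Finset (Finset α)) {v : α} {D s : Finset α}

omit [Fintype α] in
/-- On a sub-cube avoiding `v`, the trace of the deletion `delV v F` is the trace of `F`. [this work] -/
theorem tr_delV (hvD : v ∉ D) (hvs : v ∉ s) : tr (delV v F) D s = tr F D s := by
  ext U
  simp only [mem_tr, delV, mem_filter, mem_union, not_or]
  constructor
  · rintro ⟨hU, hF, _⟩; exact ⟨hU, hF⟩
  · rintro ⟨hU, hF⟩; exact ⟨hU, hF, hvD, fun h => hvs (hU h)⟩

/-- On a sub-cube avoiding `v`, the trace of the link `linkV v F` is the trace of `F` at base `D + v`. [this work] -/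
theorem tr_linkV (hvD : v ∉ D) (hvs : v ∉ s) : tr (linkV v F) D s = tr F (insert v D) s := by
  ext U
  simp only [mem_tr, linkV, mem_filter, mem_powerset, subset_erase, subset_univ, true_and, mem_union, not_or,
    Finset.insert_union]
  constructor
  · rintro ⟨hU, _, hF⟩; exact ⟨hU, hF⟩
  · rintro ⟨hU, hF⟩; exact ⟨hU, ⟨hvD, fun h => hvs (hU h)⟩, hF⟩

omit [Fintype α] in
/-- `kap` of the deletions = `kap F G` on a sub-cube avoiding `v`. [this work] -/
theorem kap_delV (hvD : v ∉ D) (hvs : v ∉ s) : kap (delV v F) (delV v G) D s = kap F G D s := by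
  unfold kap; rw [tr_delV F hvD hvs, tr_delV G hvD hvs]

/-- `kap` of the links = `kap F G` at base `D + v` on a sub-cube avoiding `v`. [this work] -/
theorem kap_linkV (hvD : v ∉ D) (hvs : v ∉ s) : kap (linkV v F) (linkV v G) D s = kap F G (insert v D) s := by
  unfold kap; rw [tr_linkV F hvD hvs, tr_linkV G hvD hvs]

omit [Fintype α] in
/-- `delV` commutes with intersection. [this work] -/
theorem delV_inter (v : α) : delV v (F ∩ G) = delV v F ∩ delV v G := by
  unfold delV; exact filter_inter_distrib _ _ _

/-- `linkV` commutes with intersection. [this work] -/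
theorem linkV_inter (v : α) : linkV v (F ∩ G) = linkV v F ∩ linkV v G := by
  ext S; simp only [linkV, mem_filter, mem_inter]; tauto

end Traces

/-! ### The relative Harris forms of the deletions and of the links -/

section RelHarris
variable {F G : Finset (Finset α)} {v : α}

/-- At a `v`-free profile, `Π'·GF(K)` and `Π·GF(K)` have the same coefficient (`Π' = GF(sets avoiding v)`). [this work] -/
theorem coeff_delVpow_mul_gf (K : Finset (Finset α)) {n : α →₀ ℕ} (hn : n v = 0) :
    (gf (delV v (univ.powerset : Finset (Finset α))) * gf K).coeff n = ((PiP : MvPolynomial α ℤ) * gf K).coeff n := by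
  unfold PiP
  rw [coeff_gf_mul_gf, coeff_gf_mul_gf]
  congr 2
  ext PS
  simp only [mem_filter, mem_product, delV, mem_powerset, subset_univ, true_and]
  constructor
  · rintro ⟨⟨_, hS⟩, h⟩; exact ⟨hS, h⟩
  · rintro ⟨hS, h⟩
    refine ⟨⟨fun hv => ?_, hS⟩, h⟩
    have := congrArg (fun f => f v) h
    simp only [Finsupp.add_apply, ind_apply, hv, if_true, hn] at this
    omega

omit [Fintype α] in
/-- A profile vanishing at `v` has `v` outside its doubled and single sets. [this work] -/
theorem not_mem_dbl_sgl_of_apply_eq_zero {n : α →₀ ℕ} (hn : n v = 0) : v ∉ dbl n ∧ v ∉ sgl n := by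
  have h : v ∉ n.support := by rw [Finsupp.mem_support_iff, not_not]; exact hn
  exact ⟨fun h' => h (dbl_subset_support n h'), fun h' => h ((dbl_union_sgl n) ▸ mem_union_right _ h')⟩

/-- **Coefficients of the Harris form of the deletions** are `kap F G (dbl n) (sgl n)` at `v`-free profiles `n ≤ 2`. [this work] -/
theorem coeff_harrisDel_eq_kap (F G : Finset (Finset α)) {n : α →₀ ℕ} (hn : ∀ i, n i ≤ 2) (hv : n v = 0) :
    (gf (delV v (univ.powerset : Finset (Finset α))) * gf (delV v F ∩ delV v G) - gf (delV v F) * gf (delV v G)).coeff n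
      = kap F G (dbl n) (sgl n) := by
  obtain ⟨hD, hs⟩ := not_mem_dbl_sgl_of_apply_eq_zero hv
  rw [coeff_sub, coeff_delVpow_mul_gf _ hv, coeff_PiP_mul_gf_eq_card_tr _ hn, coeff_gf_mul_gf_eq_card_tr _ _ hn, tr_inter,
    ← kap_delV F G hD hs]
  rfl

/-- **Coefficients of the Harris form of the links** are `kap F G (dbl n + v) (sgl n)` at `v`-free profiles `n ≤ 2`. [this work] -/
theorem coeff_harrisLink_eq_kap (F G : Finset (Finset α)) {n : α →₀ ℕ} (hn : ∀ i, n i ≤ 2) (hv : n v = 0) :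
    (gf (delV v (univ.powerset : Finset (Finset α))) * gf (linkV v F ∩ linkV v G) - gf (linkV v F) * gf (linkV v G)).coeff n
      = kap F G (insert v (dbl n)) (sgl n) := by
  obtain ⟨hD, hs⟩ := not_mem_dbl_sgl_of_apply_eq_zero hv
  rw [coeff_sub, coeff_delVpow_mul_gf _ hv, coeff_PiP_mul_gf_eq_card_tr _ hn, coeff_gf_mul_gf_eq_card_tr _ _ hn, tr_inter,
    ← kap_linkV F G hD hs]
  rfl

omit [Fintype α] in
/-- A `v`-free two-factor difference vanishes off the `v`-free profiles `≤ 2`. [this work] -/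
theorem coeff_relForm_eq_zero {K₁ K₂ K₃ K₄ : Finset (Finset α)} (h₁ : ∀ S ∈ K₁, v ∉ S) (h₂ : ∀ S ∈ K₂, v ∉ S)
    (h₃ : ∀ S ∈ K₃, v ∉ S) (h₄ : ∀ S ∈ K₄, v ∉ S) {n : α →₀ ℕ} (hn : ¬ ((∀ i, n i ≤ 2) ∧ n v = 0)) :
    (gf K₁ * gf K₂ - gf K₃ * gf K₄).coeff n = 0 := by
  by_cases hv : n v = 0
  · have hn' : ¬ ∀ i, n i ≤ 2 := fun h => hn ⟨h, hv⟩
    rw [coeff_sub, coeff_gf_mul_gf_eq_zero _ _ hn', coeff_gf_mul_gf_eq_zero _ _ hn', sub_zero]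
  · exact vfree_sub (vfree_mul (vfree_gf h₁) (vfree_gf h₂)) (vfree_mul (vfree_gf h₃) (vfree_gf h₄)) n hv

omit [Fintype α] in
/-- Members of a deletion avoid `v`. [this work] -/
theorem forall_delV_not_mem (v : α) (K : Finset (Finset α)) : ∀ S ∈ delV v K, v ∉ S := fun _ h => not_mem_of_mem_delV h

/-- Members of a link avoid `v`. [this work] -/
theorem forall_linkV_not_mem (v : α) (K : Finset (Finset α)) : ∀ S ∈ linkV v K, v ∉ S := fun _ h => not_mem_of_mem_linkV h

omit [Fintype α] in
/-- Members of an intersection of deletions avoid `v`. [this work] -/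
theorem forall_inter_not_mem {K L : Finset (Finset α)} (hK : ∀ S ∈ K, v ∉ S) : ∀ S ∈ K ∩ L, v ∉ S :=
  fun S h => hK S (mem_inter.1 h).1

/-- **The Harris form of the deletions is `≥ 0` coefficientwise** (up-sets `F, G`). [this work] -/
theorem coeff_harrisDel_nonneg (hF : IsUpperSet (F : Set (Finset α))) (hG : IsUpperSet (G : Set (Finset α))) (n : α →₀ ℕ) :
    0 ≤ (gf (delV v (univ.powerset : Finset (Finset α))) * gf (delV v F ∩ delV v G) - gf (delV v F) * gf (delV v G)).coeff n := by
  by_cases h : (∀ i, n i ≤ 2) ∧ n v = 0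
  · rw [coeff_harrisDel_eq_kap F G h.1 h.2]
    exact kap_nonneg hF hG _ _ (disjoint_dbl_sgl n)
  · rw [coeff_relForm_eq_zero (forall_delV_not_mem v _) (forall_inter_not_mem (forall_delV_not_mem v F))
      (forall_delV_not_mem v F) (forall_delV_not_mem v G) h]

/-- **The Harris form of the links is `≥ 0` coefficientwise** (up-sets `F, G`). [this work] -/
theorem coeff_harrisLink_nonneg (hF : IsUpperSet (F : Set (Finset α))) (hG : IsUpperSet (G : Set (Finset α))) (n : α →₀ ℕ) :
    0 ≤ (gf (delV v (univ.powerset : Finset (Finset α))) * gf (linkV v F ∩ linkV v G) - gf (linkV v F) * gf (linkV v G)).coeff n := by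
  by_cases h : (∀ i, n i ≤ 2) ∧ n v = 0
  · rw [coeff_harrisLink_eq_kap F G h.1 h.2]
    refine kap_nonneg hF hG _ _ (disjoint_insert_left.2 ⟨(not_mem_dbl_sgl_of_apply_eq_zero h.2).2, disjoint_dbl_sgl n⟩)
  · rw [coeff_relForm_eq_zero (forall_delV_not_mem v _) (forall_inter_not_mem (forall_linkV_not_mem v F))
      (forall_linkV_not_mem v F) (forall_linkV_not_mem v G) h]

end RelHarris

/-! ### Kleitman twice inside a sub-cube: the block of a vertex that is a loop of `F` only -/

section LoopBlock
variable {F G : Finset (Finset α)} {v : α}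

/-- **Kleitman twice.**  For up-sets `F, G`, a sub-cube `(D, s)` avoiding `v` and a family `W ⊆ G` of non-members of `F`:
`#tr W D s ≤ #{U ∈ tr N_F D s : s∖U ∈ tr (linkV v G) D s}`, `N_F` = the `v`-free non-members of `F`.  (With `𝒜 = tr N_F`, `ℬ = {U : s∖U ∈ tr (linkV G)}`
(both down-sets in `2^s`) and `𝒞 = tr G` (an up-set): `2^s·#tr W ≤ 2^s·#(𝒜∩𝒞) ≤ #𝒜·#𝒞 ≤ #𝒜·#ℬ ≤ 2^s·#(𝒜∩ℬ)`.) [this work] -/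
theorem card_tr_le_card_filter_compl (hF : IsUpperSet (F : Set (Finset α))) (hG : IsUpperSet (G : Set (Finset α)))
    {W : Finset (Finset α)} (hWG : W ⊆ G) (hWF : ∀ S ∈ W, S ∉ F) {D s : Finset α} (hvD : v ∉ D) (hvs : v ∉ s) :
    #(tr W D s) ≤ #((tr (delV v (univ.powerset : Finset (Finset α)) \ delV v F) D s).filter
        fun U => s \ U ∈ tr (linkV v G) D s) := by
  obtain ⟨𝒜, h𝒜⟩ : ∃ 𝒜 : Finset (Finset α), 𝒜 = tr (delV v (univ.powerset : Finset (Finset α)) \ delV v F) D s := ⟨_, rfl⟩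
  obtain ⟨ℬ, hℬ⟩ : ∃ ℬ : Finset (Finset α), ℬ = s.powerset.filter (fun U => s \ U ∈ tr (linkV v G) D s) := ⟨_, rfl⟩
  obtain ⟨𝒞, h𝒞⟩ : ∃ 𝒞 : Finset (Finset α), 𝒞 = tr G D s := ⟨_, rfl⟩
  obtain ⟨𝒞', h𝒞'⟩ : ∃ 𝒞' : Finset (Finset α), 𝒞' = s.powerset.filter (fun U => D ∪ U ∉ G) := ⟨_, rfl⟩
  rw [← h𝒜]
  -- membership descriptions
  have hmem𝒜 : ∀ U, U ∈ 𝒜 ↔ U ⊆ s ∧ D ∪ U ∉ F := fun U => by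
    rw [h𝒜, mem_tr, mem_sdiff]
    simp only [delV, mem_filter, mem_powerset, subset_univ, true_and, mem_union, not_or]
    constructor
    · rintro ⟨hU, _, hnot⟩; exact ⟨hU, fun hF' => hnot ⟨hF', hvD, fun h => hvs (hU h)⟩⟩
    · rintro ⟨hU, hnot⟩; exact ⟨hU, ⟨hvD, fun h => hvs (hU h)⟩, fun h => hnot h.1⟩
  have hmemℬ : ∀ U, U ∈ ℬ ↔ U ⊆ s ∧ insert v (D ∪ (s \ U)) ∈ G := fun U => by
    rw [hℬ, mem_filter, mem_powerset, mem_tr]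
    simp only [linkV, mem_filter, mem_powerset, subset_erase, subset_univ, true_and, mem_union, not_or, mem_sdiff]
    constructor
    · rintro ⟨hU, _, _, hG'⟩; exact ⟨hU, hG'⟩
    · rintro ⟨hU, hG'⟩; exact ⟨hU, sdiff_subset, ⟨hvD, fun h => hvs h.1⟩, hG'⟩
  have hmem𝒞 : ∀ U, U ∈ 𝒞 ↔ U ⊆ s ∧ D ∪ U ∈ G := fun U => by rw [h𝒞, mem_tr]
  have hmem𝒞' : ∀ U, U ∈ 𝒞' ↔ U ⊆ s ∧ D ∪ U ∉ G := fun U => by rw [h𝒞', mem_filter, mem_powerset]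
  -- down-sets
  have h𝒜low : IsLowerSet (𝒜 : Set (Finset α)) := by
    intro U U' hU'U hU
    rw [Finset.mem_coe, hmem𝒜] at hU ⊢
    exact ⟨hU'U.trans hU.1, fun h => hU.2 (hF (union_subset_union Subset.rfl hU'U) h)⟩
  have hℬlow : IsLowerSet (ℬ : Set (Finset α)) := by
    intro U U' hU'U hU
    rw [Finset.mem_coe, hmemℬ] at hU ⊢
    refine ⟨hU'U.trans hU.1, hG ?_ hU.2⟩
    exact insert_subset_insert _ (union_subset_union Subset.rfl (sdiff_subset_sdiff Subset.rfl hU'U))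
  have h𝒞'low : IsLowerSet (𝒞' : Set (Finset α)) := by
    intro U U' hU'U hU
    rw [Finset.mem_coe, hmem𝒞'] at hU ⊢
    exact ⟨hU'U.trans hU.1, fun h => hU.2 (hG (union_subset_union Subset.rfl hU'U) h)⟩
  have h𝒜s : ∀ U ∈ 𝒜, U ⊆ s := fun U hU => ((hmem𝒜 U).1 hU).1
  have hℬs : ∀ U ∈ ℬ, U ⊆ s := fun U hU => ((hmemℬ U).1 hU).1
  have h𝒞's : ∀ U ∈ 𝒞', U ⊆ s := fun U hU => ((hmem𝒞' U).1 hU).1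
  -- Kleitman (down × down correlate) twice
  have k1 := h𝒜low.le_card_inter_finset' hℬlow h𝒜s hℬs
  have k2 := h𝒜low.le_card_inter_finset' h𝒞'low h𝒜s h𝒞's
  -- splits
  have hCsplit : #𝒞 + #𝒞' = 2 ^ #s := by
    have : 𝒞 = s.powerset.filter (fun U => D ∪ U ∈ G) := h𝒞
    rw [this, h𝒞', Finset.card_filter_add_card_filter_not, card_powerset]
  have hAC : 𝒜 ∩ 𝒞 = 𝒜.filter (fun U => D ∪ U ∈ G) := by
    ext U; rw [mem_inter, mem_filter, hmem𝒞, hmem𝒜]; tauto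
  have hAC' : 𝒜 ∩ 𝒞' = 𝒜.filter (fun U => ¬ (D ∪ U ∈ G)) := by
    ext U; rw [mem_inter, hmem𝒞', mem_filter, hmem𝒜]; tauto
  have hAsplit : #(𝒜 ∩ 𝒞) + #(𝒜 ∩ 𝒞') = #𝒜 := by
    rw [hAC, hAC', Finset.card_filter_add_card_filter_not]
  -- #𝒞 ≤ #ℬ via U ↦ s \ U
  have hCB : #𝒞 ≤ #ℬ := by
    refine card_le_card_of_injOn (fun U => s \ U) (fun U hU => ?_) (fun U hU U' hU' h => ?_)
    · rw [Finset.mem_coe, hmem𝒞] at hU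
      rw [Finset.mem_coe, hmemℬ, Finset.sdiff_sdiff_eq_self hU.1]
      exact ⟨sdiff_subset, hG (subset_insert _ _) hU.2⟩
    · rw [Finset.mem_coe, hmem𝒞] at hU hU'
      have h' : s \ (s \ U) = s \ (s \ U') := by simp only at h; rw [h]
      rwa [Finset.sdiff_sdiff_eq_self hU.1, Finset.sdiff_sdiff_eq_self hU'.1] at h'
  -- the mixed inequality 2^s·#(𝒜∩𝒞) ≤ #𝒜·#𝒞
  have e1 : 2 ^ #s * #𝒜 = #𝒜 * #𝒞 + #𝒜 * #𝒞' := by rw [← Nat.mul_add, hCsplit, Nat.mul_comm]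
  have e2 : 2 ^ #s * #𝒜 = 2 ^ #s * #(𝒜 ∩ 𝒞) + 2 ^ #s * #(𝒜 ∩ 𝒞') := by rw [← Nat.mul_add, hAsplit]
  have mixed : 2 ^ #s * #(𝒜 ∩ 𝒞) ≤ #𝒜 * #𝒞 := by linarith
  -- tr W ⊆ 𝒜 ∩ 𝒞 and the chain
  have hW' : tr W D s ⊆ 𝒜 ∩ 𝒞 := by
    intro U hU
    rw [mem_tr] at hU
    rw [mem_inter, hmem𝒜, hmem𝒞]
    exact ⟨⟨hU.1, hWF _ hU.2⟩, hU.1, hWG hU.2⟩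
  have hAB : 𝒜 ∩ ℬ = 𝒜.filter (fun U => s \ U ∈ tr (linkV v G) D s) := by
    ext U; rw [mem_inter, hℬ, mem_filter, mem_filter, mem_powerset]
    constructor
    · rintro ⟨hA, _, hB⟩; exact ⟨hA, hB⟩
    · rintro ⟨hA, hB⟩; exact ⟨hA, h𝒜s U hA, hB⟩
  have hmono : #𝒜 * #𝒞 ≤ #𝒜 * #ℬ := Nat.mul_le_mul_left _ hCB
  have chain : 2 ^ #s * #(tr W D s) ≤ 2 ^ #s * #(𝒜 ∩ ℬ) :=
    (Nat.mul_le_mul_left _ (card_le_card hW')).trans (mixed.trans (hmono.trans k1))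
  rw [← hAB]
  exact Nat.le_of_mul_le_mul_left chain (Nat.two_pow_pos _)

/-- **The loop block is `≥ 0` coefficientwise**: for up-sets `F, G`, a vertex `v` and any family `W ⊆ delV v G` of non-members of `F`,
`GF(delV 2^α ∖ delV F)·GF(linkV v G) − Π'·GF(W) ∈ ℕ[s]` (the C2 difference at a vertex that is a loop of `F` but not of `G`). [this work] -/
theorem coeff_loopBlock_nonneg (hF : IsUpperSet (F : Set (Finset α))) (hG : IsUpperSet (G : Set (Finset α)))
    {W : Finset (Finset α)} (hW : W ⊆ delV v G) (hWF : ∀ S ∈ W, S ∉ F) (n : α →₀ ℕ) :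
    0 ≤ (gf (delV v (univ.powerset : Finset (Finset α)) \ delV v F) * gf (linkV v G)
        - gf (delV v (univ.powerset : Finset (Finset α))) * gf W).coeff n := by
  have hWv : ∀ S ∈ W, v ∉ S := fun S hS => not_mem_of_mem_delV (hW hS)
  have hWG : W ⊆ G := fun S hS => (mem_filter.1 (hW hS)).1
  by_cases h : (∀ i, n i ≤ 2) ∧ n v = 0
  · obtain ⟨hD, hs⟩ := not_mem_dbl_sgl_of_apply_eq_zero h.2
    rw [coeff_sub, coeff_gf_mul_gf_eq_card_tr _ _ h.1, coeff_delVpow_mul_gf _ h.2, coeff_PiP_mul_gf_eq_card_tr _ h.1, sub_nonneg]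
    exact_mod_cast card_tr_le_card_filter_compl hF hG hWG hWF hD hs
  · rw [coeff_relForm_eq_zero (fun S hS => not_mem_of_mem_delV (mem_sdiff.1 hS).1) (forall_linkV_not_mem v G)
      (forall_delV_not_mem v _) hWv h]

end LoopBlock

/-! ### Coefficients of a single generating function -/

omit [Fintype α] in
/-- The coefficient of `GF(K)` at `n` is at most `1` (the exponent vectors `1_S` are distinct). [this work] -/
theorem coeff_gf_le_one (K : Finset (Finset α)) (n : α →₀ ℕ) : (gf K).coeff n ≤ 1 := by
  rw [coeff_gf]
  have h : #(K.filter fun S => ind S = n) ≤ 1 :=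
    card_le_one.2 fun S hS S' hS' => ind_injective (((mem_filter.1 hS).2).trans ((mem_filter.1 hS').2).symm)
  exact_mod_cast h

omit [Fintype α] in
/-- If the coefficient of `GF(K)` at `n` is positive then `n = 1_S` for some member `S ∈ K`. [this work] -/
theorem exists_mem_ind_eq_of_coeff_gf_pos {K : Finset (Finset α)} {n : α →₀ ℕ} (h : 0 < (gf K).coeff n) :
    ∃ S ∈ K, ind S = n := by
  rw [coeff_gf] at h
  have h' : 0 < #(K.filter fun S => ind S = n) := by exact_mod_cast h
  obtain ⟨S, hS⟩ := card_pos.1 h'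
  exact ⟨S, (mem_filter.1 hS).1, (mem_filter.1 hS).2⟩

end Summit.CriticalPhenomena.PercolationContinuityZ3.Theorems.SahiCTCForms
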